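import Summits.RiemannHypothesis.RiemannHypothesis.Theorems.SoloInformedQuasiWeilCriterion

/-!
# Exponential slack in Weil's criterion, III: finite exceptional sets; general normalisations

Solo programme `solo-RiemannHypothesis-informed`, session 2 — part of the exact-thermometer
package; the overview, the main theorem `width_iff_weilQuadratic_sobolev_subexp` and the
references are in `SoloInformedQuasiWeil.lean`. Everything here is proved (no named facts).

Exactness of the thermometer when all but finitely many zeros are on the line
(`weilGroundEnergy_ge_of_finite_offline`), and the lower half of the thermometer in an arbitrary
mass normalisation bounded along dipole families (`abs_re_sub_half_le_of_zeroForm_slack`).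
-/

noncomputable section

open Complex Filter Set MeasureTheory
open scoped Real Topology ComplexConjugate ArithmeticFunction.vonMangoldt

namespace Summit.RiemannHypothesis.RiemannHypothesis.Theorems

open Literature.NumberTheory.LFunctions Literature.NumberTheory.LFunctions.WeilConverse

/-! ## Exactness when the exceptional set is finite -/

/-- On-line zeros contribute non-negatively to the zero-side form: for `Re ρ = 1/2`,
`1 − ρ̄ = ρ` and `m(ρ) P_g(ρ) = m(ρ) |ĝ(ρ)|² ≥ 0`. [folklore] -/
theorem re_order_mul_pairCoeff_nonneg_of_re_eq_half (g : ℝ → ℂ) {ρ : ℂ} (hρ : ρ.re = 1 / 2) :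
    0 ≤ ((riemannZetaZeroOrder ρ : ℂ) * pairCoeff g ρ).re := by
  have h1 : 1 - conj ρ = ρ := Complex.ext (by simp [hρ]; norm_num) (by simp)
  have hne : ρ ≠ 1 := by
    intro h
    rw [h, Complex.one_re] at hρ
    norm_num at hρ
  have hm : (0 : ℝ) ≤ (riemannZetaZeroOrder ρ : ℝ) := Int.cast_nonneg (riemannZetaZeroOrder_nonneg hne)
  rw [pairCoeff, h1, Complex.mul_conj]
  simp only [Complex.mul_re, Complex.intCast_re, Complex.intCast_im, Complex.ofReal_re,
    Complex.ofReal_im, mul_zero, sub_zero]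
  exact mul_nonneg hm (Complex.normSq_nonneg _)

/-- Window bound for the pairing on the `L²` sphere: `|P_g(ρ)| ≤ e^{|2 Re ρ − 1| a} · 2a · ‖g‖₂²`
for `supp g ⊆ [-a, a]` (`|ĝ(s)| ≤ e^{a |Re s − 1/2|} ‖g‖₁`, `norm_weilMellin_le_exp_mul_integral_norm`,
and Cauchy–Schwarz `‖g‖₁² ≤ 2a ‖g‖₂²`, `weilNorm1_sq_le`). [folklore] -/
theorem norm_pairCoeff_le_exp_window {g : ℝ → ℂ} (hg : IsWeilTest g) {a : ℝ} (ha : 0 < a)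
    (hsupp : tsupport g ⊆ Icc (-a) a) (ρ : ℂ) :
    ‖pairCoeff g ρ‖ ≤ Real.exp (|2 * ρ.re - 1| * a) * (2 * a * ∫ t : ℝ, ‖g t‖ ^ 2) := by
  have h1 := norm_weilMellin_le_exp_mul_integral_norm hg.1.continuous hg.2 hsupp ρ
  have h2 := norm_weilMellin_le_exp_mul_integral_norm hg.1.continuous hg.2 hsupp (1 - conj ρ)
  rw [one_sub_conj_re] at h2
  have hL := weilNorm1_sq_le hg ha hsupp
  simp only [weilNorm1, weilNorm2Sq] at hL
  have hI0 : 0 ≤ ∫ t, ‖g t‖ := integral_nonneg fun _ ↦ norm_nonneg _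
  have e1 : |1 - ρ.re - 1 / 2| = |ρ.re - 1 / 2| := by
    rw [show 1 - ρ.re - 1 / 2 = -(ρ.re - 1 / 2) by ring, abs_neg]
  have e2 : |2 * ρ.re - 1| = 2 * |ρ.re - 1 / 2| := by
    rw [show 2 * ρ.re - 1 = 2 * (ρ.re - 1 / 2) by ring, abs_mul, abs_two]
  calc ‖pairCoeff g ρ‖ = ‖weilMellin g ρ‖ * ‖weilMellin g (1 - conj ρ)‖ := by
        rw [pairCoeff, norm_mul, Complex.norm_conj]
    _ ≤ (Real.exp (a * |ρ.re - 1 / 2|) * ∫ t, ‖g t‖) *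
          (Real.exp (a * |1 - ρ.re - 1 / 2|) * ∫ t, ‖g t‖) :=
        mul_le_mul h1 h2 (norm_nonneg _) (mul_nonneg (Real.exp_pos _).le hI0)
    _ = Real.exp (|2 * ρ.re - 1| * a) * (∫ t, ‖g t‖) ^ 2 := by
        rw [e1, e2]
        rw [show 2 * |ρ.re - 1 / 2| * a = a * |ρ.re - 1 / 2| + a * |ρ.re - 1 / 2| by ring,
          Real.exp_add]
        ring
    _ ≤ Real.exp (|2 * ρ.re - 1| * a) * (2 * a * ∫ t : ℝ, ‖g t‖ ^ 2) := by gcongr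

/-- **Finitely many exceptions: the rate of negativity is at most the width.** If every
non-trivial zero off the critical line lies in a finite set `F`, and `|Re ρ − 1/2| ≤ Θ/2` for all
non-trivial zeros, then `ε(a) ≥ −(C a) e^{Θ a}` for every `a > 0` (`C = 2 ∑_{ρ ∈ F} m(ρ)`): split
`Re Q(g) = ∑_ρ Re(m(ρ) P_g(ρ))` (`combShapeDetection_zeroForm_eq_weilQuadratic`) into the on-line terms, which are
`≥ 0`, and the finitely many exceptional ones, each `≥ −m(ρ) e^{Θ a} 2a ‖g‖₂²`. Together with
`frequently_weilGroundEnergy_lt_of_offline_zero` this pins the exponential rate of negativity of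
`ε` to exactly `Θ = max |2 Re ρ − 1|` in this case. [folklore] -/
theorem weilGroundEnergy_ge_of_finite_offline (F : Finset ℂ)
    (hF : ∀ ρ ∈ ZetaZeros.riemannZetaNontrivialZeros, ρ.re ≠ 1 / 2 → ρ ∈ F) {Θ : ℝ}
    (hΘ : ∀ ρ ∈ ZetaZeros.riemannZetaNontrivialZeros, |ρ.re - 1 / 2| ≤ Θ / 2) :
    ∃ C : ℝ, 0 ≤ C ∧ ∀ a : ℝ, 0 < a → -(C * a * Real.exp (Θ * a)) ≤ weilGroundEnergy a := by
  classical
  have hfin : (Subtype.val ⁻¹' (F : Set ℂ) : Set ZetaZeros.riemannZetaNontrivialZeros).Finite :=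
    F.finite_toSet.preimage Subtype.val_injective.injOn
  set T : Finset ZetaZeros.riemannZetaNontrivialZeros := hfin.toFinset with hT
  set M : ℝ := ∑ ρ ∈ T, (riemannZetaZeroOrder (ρ : ℂ) : ℝ) with hM
  have hord : ∀ ρ : ZetaZeros.riemannZetaNontrivialZeros, (0 : ℝ) ≤ (riemannZetaZeroOrder (ρ : ℂ) : ℝ) :=
    fun ρ ↦ Int.cast_nonneg (by
      have := ZetaZeros.riemannZetaNontrivialZeros.one_le_order ρ.2
      omega)
  have hM0 : 0 ≤ M := Finset.sum_nonneg fun ρ _ ↦ hord ρ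
  refine ⟨2 * M, by positivity, fun a ha ↦ ?_⟩
  refine le_weilGroundEnergy_of_forall ha fun g hg hsupp hn ↦ ?_
  rw [← combShapeDetection_zeroForm_eq_weilQuadratic hg, zeroForm, Complex.re_tsum (summable_pairCoeff hg)]
  have hsum : Summable fun ρ : ZetaZeros.riemannZetaNontrivialZeros ↦
      ((riemannZetaZeroOrder (ρ : ℂ) : ℂ) * pairCoeff g ρ).re :=
    (Complex.hasSum_re (summable_pairCoeff hg).hasSum).summable
  have hout : ∀ ρ, ρ ∉ T → 0 ≤ ((riemannZetaZeroOrder (ρ : ℂ) : ℂ) * pairCoeff g ρ).re := by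
    intro ρ hρT
    apply re_order_mul_pairCoeff_nonneg_of_re_eq_half
    by_contra hne
    exact hρT (hfin.mem_toFinset.2 (hF ρ ρ.2 hne))
  refine le_trans ?_ (hsum.sum_le_tsum T hout)
  have hterm : ∀ ρ ∈ T, -((riemannZetaZeroOrder (ρ : ℂ) : ℝ) * (Real.exp (Θ * a) * (2 * a))) ≤
      ((riemannZetaZeroOrder (ρ : ℂ) : ℂ) * pairCoeff g ρ).re := by
    intro ρ _
    have hP := norm_pairCoeff_le_exp_window hg ha hsupp (ρ : ℂ)
    rw [hn, mul_one] at hP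
    have hexp : Real.exp (|2 * (ρ : ℂ).re - 1| * a) ≤ Real.exp (Θ * a) := by
      apply Real.exp_le_exp.2
      apply mul_le_mul_of_nonneg_right _ ha.le
      have := hΘ ρ ρ.2
      rw [show 2 * (ρ : ℂ).re - 1 = 2 * ((ρ : ℂ).re - 1 / 2) by ring, abs_mul, abs_two]
      linarith
    have hPn : ‖pairCoeff g ρ‖ ≤ Real.exp (Θ * a) * (2 * a) := by
      refine hP.trans ?_
      exact mul_le_mul_of_nonneg_right hexp (by positivity)
    calc -((riemannZetaZeroOrder (ρ : ℂ) : ℝ) * (Real.exp (Θ * a) * (2 * a)))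
        ≤ -((riemannZetaZeroOrder (ρ : ℂ) : ℝ) * ‖pairCoeff g ρ‖) := by
          apply neg_le_neg
          exact mul_le_mul_of_nonneg_left hPn (hord ρ)
      _ = -‖(riemannZetaZeroOrder (ρ : ℂ) : ℂ) * pairCoeff g ρ‖ := by
          rw [norm_mul, Complex.norm_intCast, abs_of_nonneg (hord ρ)]
      _ ≤ ((riemannZetaZeroOrder (ρ : ℂ) : ℂ) * pairCoeff g ρ).re :=
          (abs_le.1 (Complex.abs_re_le_norm _)).1
  calc -(2 * M * a * Real.exp (Θ * a))
      = ∑ ρ ∈ T, -((riemannZetaZeroOrder (ρ : ℂ) : ℝ) * (Real.exp (Θ * a) * (2 * a))) := by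
        rw [Finset.sum_neg_distrib, ← Finset.sum_mul, ← hM]; ring
    _ ≤ ∑ ρ ∈ T, ((riemannZetaZeroOrder (ρ : ℂ) : ℂ) * pairCoeff g ρ).re := Finset.sum_le_sum hterm

/-! ## The thermometer in an arbitrary dipole-bounded normalisation

The proof of the strip bound only ever applies the slack hypothesis to the centred dipoles
`g(· + x/2) + c g(· - x/2)` (`|c| = 1`, `x ≥ 0`) of a fixed bump `g`. Hence the `L²`-mass in the
hypothesis may be replaced by ANY functional `Nf` of the test function that stays bounded along the
dipole family of each test function — for instance the Sobolev mass `‖φ‖₂² + ‖φ'‖₂²`, for which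
the converse inequality holds unconditionally at the rate of the width of the critical strip
(`zeroForm_re_ge_sobolev_of_width`): in that normalisation the thermometer is EXACT. -/

/-- `L²`-mass of a dipole: `∫ |g₁ + c g₁(· - x)|² ≤ 4 ∫ |g₁|²` for `|c| = 1`. [folklore] -/
theorem integral_norm_sq_translateMix_le {g₁ : ℝ → ℂ} (hg₁ : IsWeilTest g₁) {c : ℂ}
    (hc : ‖c‖ = 1) (x : ℝ) :
    ∫ t : ℝ, ‖translateMix g₁ c x t‖ ^ 2 ≤ 4 * ∫ t : ℝ, ‖g₁ t‖ ^ 2 := by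
  have hpt : ∀ t, ‖translateMix g₁ c x t‖ ^ 2 ≤ 2 * ‖g₁ t‖ ^ 2 + 2 * ‖g₁ (t - x)‖ ^ 2 := by
    intro t
    have e : translateMix g₁ c x t = g₁ t + c * g₁ (t - x) := rfl
    have h1 : ‖g₁ t + c * g₁ (t - x)‖ ≤ ‖g₁ t‖ + ‖g₁ (t - x)‖ := by
      calc ‖g₁ t + c * g₁ (t - x)‖ ≤ ‖g₁ t‖ + ‖c * g₁ (t - x)‖ := norm_add_le _ _
        _ = ‖g₁ t‖ + ‖g₁ (t - x)‖ := by rw [norm_mul, hc, one_mul]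
    rw [e]
    calc ‖g₁ t + c * g₁ (t - x)‖ ^ 2 ≤ (‖g₁ t‖ + ‖g₁ (t - x)‖) ^ 2 :=
          pow_le_pow_left₀ (norm_nonneg _) h1 2
      _ ≤ 2 * ‖g₁ t‖ ^ 2 + 2 * ‖g₁ (t - x)‖ ^ 2 := by
          nlinarith [sq_nonneg (‖g₁ t‖ - ‖g₁ (t - x)‖)]
  have hi1 : Integrable fun t : ℝ ↦ ‖g₁ t‖ ^ 2 := hg₁.integrable_norm_sq
  have hi2 : Integrable fun t : ℝ ↦ ‖g₁ (t - x)‖ ^ 2 := hi1.comp_sub_right x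
  have hI₂ : ∫ t : ℝ, ‖g₁ (t - x)‖ ^ 2 = ∫ t : ℝ, ‖g₁ t‖ ^ 2 :=
    integral_sub_right_eq_self (fun t : ℝ ↦ ‖g₁ t‖ ^ 2) x
  calc ∫ t : ℝ, ‖translateMix g₁ c x t‖ ^ 2
      ≤ ∫ t : ℝ, (2 * ‖g₁ t‖ ^ 2 + 2 * ‖g₁ (t - x)‖ ^ 2) :=
        integral_mono_of_nonneg (Eventually.of_forall fun t ↦ by positivity)
          ((hi1.const_mul 2).add (hi2.const_mul 2)) (Eventually.of_forall hpt)
    _ = 4 * ∫ t : ℝ, ‖g₁ t‖ ^ 2 := by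
        rw [integral_add (hi1.const_mul 2) (hi2.const_mul 2), integral_const_mul,
          integral_const_mul, hI₂]
        ring

/-- **Slack polarisation in a general normalisation.** Suppose
`Re Q(φ) ≥ -C e^{κ a} Nf(φ)` for every test `φ` supported in `[-a, a]`, `a ≥ a₀` (`κ ≥ 0`), where
`Nf` is any real functional, and `|Nf| ≤ M` along the dipole family
`g(· + x/2) + c g(· + x/2 - x)` (`|c| = 1`, `x ≥ 0`) of the test function `g` (supported in
`[-b, b]`). Then `|B_g(x)| ≤ (|Re Q(g)| + |C| e^{κ(|a₀| + b)} M) e^{(κ/2) x}` for `x ≥ 0`.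
[folklore] -/
theorem norm_expSum_le_of_slack {Nf : (ℝ → ℂ) → ℝ} {κ C a₀ : ℝ} (hκ : 0 ≤ κ)
    (H : ∀ a : ℝ, a₀ ≤ a → ∀ φ : ℝ → ℂ, IsWeilTest φ → tsupport φ ⊆ Icc (-a) a →
      -(C * Real.exp (κ * a)) * Nf φ ≤ (zeroForm φ).re)
    {g : ℝ → ℂ} (hg : IsWeilTest g) {b : ℝ} (hb : 0 ≤ b) (hsupp : tsupport g ⊆ Icc (-b) b)
    {M : ℝ} (hM : ∀ (c : ℂ) (x : ℝ), ‖c‖ = 1 → 0 ≤ x →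
      |Nf (translateMix (weilTranslate g (-(x / 2))) c x)| ≤ M)
    {x : ℝ} (hx : 0 ≤ x) :
    ‖expSum g x‖ ≤ (|(zeroForm g).re| + |C| * Real.exp (κ * (|a₀| + b)) * M) *
      Real.exp (κ / 2 * x) := by
  have hM0 : 0 ≤ M := (abs_nonneg _).trans (hM 1 0 (by simp) le_rfl)
  set B := expSum g x with hBdef
  have hE1 : 1 ≤ Real.exp (κ / 2 * x) := Real.one_le_exp (by positivity)
  by_cases hB : B = 0
  · rw [hB, norm_zero]; positivity
  set g₁ : ℝ → ℂ := weilTranslate g (-(x / 2)) with hg₁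
  have hg₁t : IsWeilTest g₁ := hg.weilTranslate _
  have hQ₁ : zeroForm g₁ = zeroForm g := zeroForm_weilTranslate g _
  have hB₁ : expSum g₁ x = B := expSum_weilTranslate g _ x
  have hA₁ : expSum' g₁ x = conj B := by
    rw [← hB₁, ← conj_expSum' g₁ x, Complex.conj_conj]
  have hs₁ : tsupport g₁ ⊆ Icc (-b + -(x / 2)) (b + -(x / 2)) := tsupport_weilTranslate_subset hsupp _
  have hn0 : ‖B‖ ≠ 0 := norm_ne_zero_iff.2 hB
  have hn : (‖B‖ : ℂ) ≠ 0 := by exact_mod_cast hn0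
  set c : ℂ := -conj B / (‖B‖ : ℂ) with hc
  have hcB : c * B = -(‖B‖ : ℂ) := by
    rw [hc, div_mul_eq_mul_div, neg_mul, Complex.conj_mul', neg_div]
    congr 1
    rw [sq, mul_div_assoc, div_self hn, mul_one]
  have hcn : ‖c‖ = 1 := by
    rw [hc, norm_div, norm_neg, Complex.norm_conj, Complex.norm_real, Real.norm_eq_abs, abs_norm,
      div_self hn0]
  have hc1 : Complex.normSq c = 1 := by
    rw [Complex.normSq_eq_norm_sq, hcn, one_pow]
  set a : ℝ := max a₀ (b + x / 2) with ha
  have ha₀ : a₀ ≤ a := le_max_left _ _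
  have hba : b + x / 2 ≤ a := le_max_right _ _
  have ha_le : a ≤ |a₀| + b + x / 2 :=
    max_le (by linarith [le_abs_self a₀]) (by linarith [abs_nonneg a₀])
  have hφt : IsWeilTest (translateMix g₁ c x) := isWeilTest_translateMix hg₁t c x
  have hφs : tsupport (translateMix g₁ c x) ⊆ Icc (-a) a := by
    have h2 : tsupport (fun t ↦ c * weilTranslate g₁ x t) ⊆ Icc (-a) a := by
      refine tsupport_mul_subset_right.trans ?_
      refine (tsupport_weilTranslate_subset hs₁ x).trans (Icc_subset_Icc (by linarith) (by linarith))
    refine (tsupport_add _ _).trans (union_subset (hs₁.trans (Icc_subset_Icc ?_ ?_)) h2) <;>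
      linarith
  have h0 := H a ha₀ _ hφt hφs
  rw [zeroForm_translateMix hg₁t c x, hQ₁, hA₁, hB₁, ← map_mul, hcB, hc1] at h0
  simp only [map_neg, Complex.conj_ofReal, Complex.ofReal_one, one_mul, add_re, neg_re,
    Complex.ofReal_re] at h0
  have hea : Real.exp (κ * a) ≤ Real.exp (κ * (|a₀| + b)) * Real.exp (κ / 2 * x) := by
    rw [← Real.exp_add]
    exact Real.exp_le_exp.2 (by nlinarith)
  have hea0 : 0 < Real.exp (κ * a) := Real.exp_pos _
  have hMφ := hM c x hcn hx
  have h1 : -(|C| * Real.exp (κ * a) * M) ≤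
      -(C * Real.exp (κ * a)) * Nf (translateMix g₁ c x) := by
    have h2 : |C * Real.exp (κ * a) * Nf (translateMix g₁ c x)| ≤ |C| * Real.exp (κ * a) * M := by
      rw [abs_mul, abs_mul, abs_of_pos hea0]
      exact mul_le_mul_of_nonneg_left hMφ (by positivity)
    have h3 := le_abs_self (C * Real.exp (κ * a) * Nf (translateMix g₁ c x))
    rw [neg_mul]
    linarith
  have hQabs : (zeroForm g).re ≤ |(zeroForm g).re| * Real.exp (κ / 2 * x) :=
    (le_abs_self _).trans (le_mul_of_one_le_right (abs_nonneg _) hE1)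
  have h5 : |C| * Real.exp (κ * a) * M ≤
      |C| * Real.exp (κ * (|a₀| + b)) * M * Real.exp (κ / 2 * x) := by
    have h6 := mul_le_mul_of_nonneg_left hea (abs_nonneg C)
    have h7 := mul_le_mul_of_nonneg_right h6 hM0
    calc |C| * Real.exp (κ * a) * M ≤ |C| * (Real.exp (κ * (|a₀| + b)) * Real.exp (κ / 2 * x)) * M :=
          h7
      _ = |C| * Real.exp (κ * (|a₀| + b)) * M * Real.exp (κ / 2 * x) := by ring
  have h6 : 0 ≤ |C| * Real.exp (κ * (|a₀| + b)) * M * Real.exp (κ / 2 * x) := by positivity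
  have h7 : ‖B‖ ≤ (zeroForm g).re + (|C| * Real.exp (κ * a) * M) / 2 := by linarith
  calc ‖B‖ ≤ |(zeroForm g).re| * Real.exp (κ / 2 * x) +
        |C| * Real.exp (κ * (|a₀| + b)) * M * Real.exp (κ / 2 * x) := by linarith
    _ = (|(zeroForm g).re| + |C| * Real.exp (κ * (|a₀| + b)) * M) * Real.exp (κ / 2 * x) := by
        ring

/-- `m(ρ₀) P_g(ρ₀) = 0` beyond the growth rate, general normalisation (`Nf` bounded along the
dipole family of every test function). [folklore] -/
theorem order_mul_pairCoeff_eq_zero_of_slack {Nf : (ℝ → ℂ) → ℝ} {κ C a₀ : ℝ} (hκ : 0 ≤ κ)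
    (H : ∀ a : ℝ, a₀ ≤ a → ∀ φ : ℝ → ℂ, IsWeilTest φ → tsupport φ ⊆ Icc (-a) a →
      -(C * Real.exp (κ * a)) * Nf φ ≤ (zeroForm φ).re)
    (hNf : ∀ g : ℝ → ℂ, IsWeilTest g → ∃ M : ℝ, ∀ (c : ℂ) (x : ℝ), ‖c‖ = 1 → 0 ≤ x →
      |Nf (translateMix (weilTranslate g (-(x / 2))) c x)| ≤ M)
    {g : ℝ → ℂ} (hg : IsWeilTest g) {ρ₀ : ℂ} (hρ₀ : ρ₀ ∈ ZetaZeros.riemannZetaNontrivialZeros)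
    (hre : κ / 2 < ρ₀.re - 1 / 2) :
    (riemannZetaZeroOrder ρ₀ : ℂ) * pairCoeff g ρ₀ = 0 := by
  obtain ⟨b, hb, hsupp⟩ := exists_tsupport_subset_Icc hg.2
  obtain ⟨M, hM⟩ := hNf g hg
  have h := sum_fiber_eq_zero_of_exp_growth (ι := ZetaZeros.riemannZetaNontrivialZeros)
    (c := fun ρ ↦ (riemannZetaZeroOrder (ρ : ℂ) : ℂ) * pairCoeff g ρ)
    (lam := fun ρ ↦ (ρ : ℂ) - 1 / 2) (R := 1 / 2)
    (M := |(zeroForm g).re| + |C| * Real.exp (κ * (|a₀| + b)) * M)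
    (summable_norm_pairCoeff hg) (fun ρ ↦ (le_abs_self _).trans (abs_re_sub_half_le ρ.2))
    (fun z ↦ ?_) (κ := κ / 2) (fun x hx ↦ norm_expSum_le_of_slack hκ H hg hb hsupp hM hx)
    (μ := ρ₀ - 1 / 2) (by simpa [sub_re] using hre) {⟨ρ₀, hρ₀⟩} (fun ρ ↦ ?_)
  · simpa using h
  · refine ⟨1, one_pos, ?_⟩
    refine ((riemannZetaNontrivialZeros_finite_inter_ball (z + 1 / 2) 1).preimage
      (Subtype.val_injective.injOn)).subset fun ρ hρ ↦ ?_
    simp only [mem_setOf_eq, Metric.mem_ball, dist_eq_norm] at hρ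
    refine ⟨ρ.2, ?_⟩
    rw [Metric.mem_ball, dist_eq_norm]
    rwa [show (ρ : ℂ) - (z + 1 / 2) = (ρ : ℂ) - 1 / 2 - z by ring]
  · rw [Finset.mem_singleton, sub_left_inj]
    constructor
    · rintro rfl; rfl
    · intro h; exact Subtype.ext h

/-- **Strip bound in a general normalisation**: if `Re Q(φ) ≥ -C e^{κ a} Nf(φ)` on every window
`[-a, a]`, `a ≥ a₀` (`κ ≥ 0`), for a functional `Nf` bounded along the dipole family of every test
function, then every non-trivial zero has `|Re ρ - 1/2| ≤ κ/2`. [folklore] -/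
theorem abs_re_sub_half_le_of_zeroForm_slack {Nf : (ℝ → ℂ) → ℝ} {κ C a₀ : ℝ} (hκ : 0 ≤ κ)
    (H : ∀ a : ℝ, a₀ ≤ a → ∀ φ : ℝ → ℂ, IsWeilTest φ → tsupport φ ⊆ Icc (-a) a →
      -(C * Real.exp (κ * a)) * Nf φ ≤ (zeroForm φ).re)
    (hNf : ∀ g : ℝ → ℂ, IsWeilTest g → ∃ M : ℝ, ∀ (c : ℂ) (x : ℝ), ‖c‖ = 1 → 0 ≤ x →
      |Nf (translateMix (weilTranslate g (-(x / 2))) c x)| ≤ M)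
    {ρ : ℂ} (hρ : ρ ∈ ZetaZeros.riemannZetaNontrivialZeros) : |ρ.re - 1 / 2| ≤ κ / 2 := by
  -- one-sided bound at a zero `ρ'`, from a narrow bump
  have key : ∀ ρ' ∈ ZetaZeros.riemannZetaNontrivialZeros, ρ'.re - 1 / 2 ≤ κ / 2 := by
    intro ρ' hρ'
    by_contra hre
    push Not at hre
    obtain ⟨g, hg, hpos⟩ := exists_isWeilTest_re_weilMellin_pos ρ'.im
    have h := order_mul_pairCoeff_eq_zero_of_slack hκ H hNf hg hρ' hre
    have hm : (riemannZetaZeroOrder ρ' : ℂ) ≠ 0 := by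
      have := ZetaZeros.riemannZetaNontrivialZeros.one_le_order hρ'
      exact_mod_cast (by omega : riemannZetaZeroOrder ρ' ≠ 0)
    have h1 : weilMellin g ρ' ≠ 0 := by
      intro h0
      have := hpos ρ'.re
      rw [show (ρ'.re : ℂ) + ρ'.im * I = ρ' from Complex.re_add_im ρ', h0, Complex.zero_re] at this
      exact lt_irrefl _ this
    have h2 : weilMellin g (1 - conj ρ') ≠ 0 := by
      intro h0
      have := hpos (1 - ρ'.re)
      rw [show ((1 - ρ'.re : ℝ) : ℂ) + ρ'.im * I = 1 - conj ρ' from ?_, h0, Complex.zero_re] at this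
      · exact lt_irrefl _ this
      · apply Complex.ext <;> simp
    exact (mul_ne_zero hm (mul_ne_zero h1 ((map_ne_zero _).2 h2))) h
  have h1 := key ρ hρ
  have h2 := key _ (ZetaZeros.riemannZetaNontrivialZeros.one_sub_conj_mem hρ)
  rw [one_sub_conj_re] at h2
  rw [abs_sub_le_iff]
  constructor <;> linarith

end Summit.RiemannHypothesis.RiemannHypothesis.Theorems
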